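import Summits.FinalStateConjecture.FinalStateConjecture.Cruxes.ChannelsResolveTameDevelopmentsR.K2REquivPhi
import Summits.FinalStateConjecture.FinalStateConjecture.Theorems.PhotonSphereChannelsDarkFutureDefs

/-!
# Strategy census s11 (independent, family `s`) — the TYPED attempts
# crux `ChannelsResolveTameDevelopmentsR` (K2R, stmt-FinalStateConjecture-17430), route PhotonSphereChannels

Companion of `STRATEGY-CENSUS-s11.md` (planner `cstrat-…-s11`, 2026-08-17). Everything here is
sorry-free bookkeeping over EXISTING declarations; no statement of the route is restated as an item,
nothing here is a line or a stub. The sections follow the census headings: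

* §0 named pieces: the T2 conclusion at one development (`Settles`), the ray-theoretic horizon
  predicate of route BondiDrainDispersal (`HasEventHorizonR`), the "Kerr-or-flat limits" predicate
  over the TameHull vocabulary (`KerrOrFlatLimits`);
* §1 WEAKER INTERMEDIATE — hypothesis trading, the only slack the frame `closes : K1R → K2R → K3 → S`
  leaves: for ANY development predicate `G`, `K2RWith G` (K2R with `G` as an extra hypothesis) and
  `K3With G` (K3 with `G` added to the tame-generic bundle) still decide the summit
  (`closes_rekeyed`), `K2R → K2RWith G` (`k2RWith_of_k2R`), and `G := True` is the route verbatim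
  (`k2R_iff_k2RWith_trivially`, `k3_iff_k3With_trivially`; the instance `G := Trivially` of
  `closes_rekeyed` is the route's `closes` and is deliberately not restated);
* §2 DECOMPOSITION — the horizon case split `K2R ↔ K2RWith (¬ horizon) ∧ K2RWith horizon`
  (`k2R_iff_pieces`), and the abstract Kenig–Merle cut `HypForces G → K2RWith G → K2R`
  (`k2R_of_forces_of_with`), of which the live line `tame-lasalle-dock` is the instance
  `G := KerrOrFlatLimits`;
* §3 STRENGTHEN — `K2RPlus Extra` (conclusion strengthened by any extra clause on the decomposition,
  e.g. `PolynomialRate`) implies K2R (`k2R_of_plus`);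
* §4 NEGATION — the typed shape of the time-periodic / stationary counterexample
  (`PeriodicTameNonSettlingWitnessExists → ¬ K2R`, `not_k2R_of_periodicWitness`), an instance of the
  disprover's `Disproof.not_k2R_iff_nonempty`.

Why none of this is leverage is argued in the markdown census; the Lean only certifies that the
attempts are well-typed and that the claimed implications are the trivial ones they are said to be.
-/

set_option linter.dupNamespace false
set_option maxSynthPendingDepth 3

noncomputable section

open Set Filter Function TopologicalSpace
open scoped Topology Manifold ContDiff ENNReal NNReal

namespace Summit.FinalStateConjecture.FinalStateConjecture.Cruxes.ChannelsResolveTameDevelopmentsR.CensusS11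

open Literature.Geometry.Lorentzian
open Summit.FinalStateConjecture.FinalStateConjecture.Theses.PhotonSphereChannels
open Summit.FinalStateConjecture.FinalStateConjecture.Theorems.TameHull

/-! ### §0 Named pieces -/

section OneDevelopment

variable {X : Type} [TopologicalSpace X] [ChartedSpace E3 X] [IsManifold (𝓡 3) ∞ X]
  [T2Space X] [SecondCountableTopology X] [ConnectedSpace X] {D : InitialDataSet (𝓡 3) X}

/-- The T2 conclusion of K2R at ONE development, verbatim: an honest, ray-containing, exhaustive,
future-oriented `C²` final-state decomposition. [cite: DafermosLuk2017, Conjecture 1] -/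
def Settles (𝒟 : VacuumCauchyDevelopment D) : Prop :=
  ∃ (O : Set 𝒟.carrier) (d : FinalStateDecomposition 𝒟.toSpacetime O 2),
    O = Summit.FinalStateConjecture.exteriorOf 𝒟.toCauchyDevelopment d.charted ∧
      Summit.FinalStateConjecture.RaysStayInClosure 𝒟.toCauchyDevelopment O ∧
        Summit.FinalStateConjecture.HasExhaustiveCharts d ∧
          Summit.FinalStateConjecture.IsFutureOriented d

/-- The ray-theoretic EVENT HORIZON predicate (route BondiDrainDispersal, items 9976/18656/18657,
verbatim): some event lies outside the chronological past of the future branch of every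
future-complete normalised null ray from the data hypersurface. [cite: HawkingEllis1973, §9.2] -/
def HasEventHorizonR (𝒟 : VacuumCauchyDevelopment D) : Prop :=
  ∀ [𝒟.metric.HasLeviCivita], ∃ q : 𝒟.carrier, ∀ (p : X) (γ : ℝ → 𝒟.carrier) (dom : Set ℝ),
    𝒟.metric.IsNormalisedNullRayFrom 𝒟.timeOrientation 𝒟.embed 𝒟.normal p γ dom → ¬ BddAbove dom →
      q ∉ 𝒟.metric.chronologicalPast 𝒟.timeOrientation (γ '' (dom ∩ Set.Ici 0))

/-- Hypothesis (iii) "KERR-OR-FLAT LIMITS" over the TameHull vocabulary: every hull element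
(pointed `C²_loc` limit of the development along a future-escaping sequence of outer points, in any
tameness class) is Minkowski space or has a Kerr domain of outer communications of positive mass.
This is the rigidity content `(zero news ⇒ stationary) ∘ (stationary ⇒ Kerr)` that K2R (all data)
contains and the GENERIC summit does not need. [cite: Anderson2004, Def. 1.1] -/
def KerrOrFlatLimits (𝒟 : VacuumCauchyDevelopment D) : Prop :=
  ∀ [𝒟.metric.HasLeviCivita], ∀ (Λ : ℝ≥0) (r₀ : ℝ) (q : ℕ → 𝒟.carrier) (𝓢 : Spacetime.{0} 4)
    (E : EndDatum 𝓢) (p : 𝓢.carrier), IsHullElement 𝒟 Λ r₀ q 𝓢 E p →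
      IsMinkowski 𝓢 ∨ ∃ M a : ℝ, 0 < M ∧ IsKerrDoc 𝓢 E.doc M a

end OneDevelopment

/-- A DEVELOPMENT PREDICATE, polymorphic in the data manifold: the shape of a hypothesis that can
be traded between K2R (where it is assumed of every development) and K3 (where it is demanded
tame-generically). [folklore] -/
def DevPred : Type 1 :=
  ∀ (X : Type) [TopologicalSpace X] [ChartedSpace E3 X] [IsManifold (𝓡 3) ∞ X] [T2Space X]
    [SecondCountableTopology X] [ConnectedSpace X] (D : InitialDataSet (𝓡 3) X),
    VacuumCauchyDevelopment D → Prop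

/-- The trivial predicate (trading nothing). [folklore] -/
def Trivially : DevPred := fun _ _ _ _ _ _ _ _ _ => True

/-- The horizonless case as a predicate. [folklore] -/
def Horizonless : DevPred := fun _ _ _ _ _ _ _ _ 𝒟 => ¬ HasEventHorizonR 𝒟

/-- The black-hole case as a predicate. [folklore] -/
def BlackHole : DevPred := fun _ _ _ _ _ _ _ _ 𝒟 => HasEventHorizonR 𝒟

/-- Kerr-or-flat limits as a predicate. [folklore] -/
def KerrOrFlat : DevPred := fun _ _ _ _ _ _ _ _ 𝒟 => KerrOrFlatLimits 𝒟

/-! ### §1 Weaker intermediate: hypothesis trading `Q ↦ Q ∧ G` -/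

/-- **K2R with the extra hypothesis `G`** (`K2R♭_G`): for every admissible datum and every MGHD with
complete `𝓘⁺`, (i) no extremal remnant, (ii) tame outer region AND `G`, the T2 conclusion. For
`G := Trivially` this is K2R (K1R being proved); for any `G` it is implied by K2R. [cite: DafermosLuk2017, Conjecture 1] -/
def K2RWith (G : DevPred) : Prop :=
  ∀ (X : Type) [TopologicalSpace X] [ChartedSpace E3 X] [IsManifold (𝓡 3) ∞ X] [T2Space X]
    [SecondCountableTopology X] [ConnectedSpace X], ∀ D ∈ admissibleVacuumData X,
    ∀ 𝒟 : VacuumCauchyDevelopment D, 𝒟.IsMaximal →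
      Summit.FinalStateConjecture.HasCompleteNullInfinity 𝒟.toCauchyDevelopment →
        NoExtremalRemnant 𝒟 → TameOuter 𝒟 → G X D 𝒟 → Settles 𝒟

/-- **K3 with `G` added to the generic bundle** (`K3♯_G`): tame-Christodoulou-generically an MGHD
exists and every MGHD has complete `𝓘⁺`, (i), (ii) AND `G`. For `G := Trivially` this is
`TameCensorship` verbatim. [cite: Christodoulou1999, p. A27] -/
def K3With (G : DevPred) : Prop :=
  ∀ (X : Type) [TopologicalSpace X] [ChartedSpace E3 X] [IsManifold (𝓡 3) ∞ X] [T2Space X]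
    [SecondCountableTopology X] [ConnectedSpace X],
    InitialDataSet.IsTameChristodoulouGeneric (admissibleVacuumData X)
      (fun D => (∃ 𝒟 : VacuumCauchyDevelopment D, 𝒟.IsMaximal) ∧
        ∀ 𝒟 : VacuumCauchyDevelopment D, 𝒟.IsMaximal →
          Summit.FinalStateConjecture.HasCompleteNullInfinity 𝒟.toCauchyDevelopment ∧
            NoExtremalRemnant 𝒟 ∧ TameOuter 𝒟 ∧ G X D 𝒟) 1

/-- K2R implies every traded form (the extra hypothesis is ignored). [folklore] -/
theorem k2RWith_of_k2R (G : DevPred) (h : ChannelsResolveTameDevelopmentsR) : K2RWith G := by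
  intro X _ _ _ _ _ _ D hD 𝒟 hmax hcomp hi hii _
  exact h UniformPhotonSphereChannelsR_holds X D hD 𝒟 hmax hcomp ⟨hi, hii⟩

/-- Trading nothing is the crux verbatim (K1R is a theorem of the tree). [folklore] -/
theorem k2R_iff_k2RWith_trivially : ChannelsResolveTameDevelopmentsR ↔ K2RWith Trivially := by
  refine ⟨k2RWith_of_k2R _, fun h _ X _ _ _ _ _ _ D hD 𝒟 hmax hcomp hyp => ?_⟩
  exact h X D hD 𝒟 hmax hcomp hyp.1 hyp.2 trivial

/-- Tame Christodoulou-genericity (codimension 1) is monotone in the property (the witnessing end,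
family, tameness and immersion are kept; only exceptional-set membership is transported) — the
`mono` step of the route's `closes`, isolated. [cite: Christodoulou1999, p. A27] -/
theorem isTameChristodoulouGeneric_mono {X : Type} [TopologicalSpace X] [ChartedSpace E3 X]
    [IsManifold (𝓡 3) ∞ X] [T2Space X] [SecondCountableTopology X] [ConnectedSpace X]
    {P Q : InitialDataSet (𝓡 3) X → Prop}
    (hQP : ∀ D ∈ admissibleVacuumData X, Q D → P D)
    (hQ : InitialDataSet.IsTameChristodoulouGeneric (admissibleVacuumData X) Q 1) :
    InitialDataSet.IsTameChristodoulouGeneric (admissibleVacuumData X) P 1 := by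
  intro D hD
  obtain ⟨e, F, hF, himm, h0, hinj, hadm, hexc⟩ := hQ D ⟨hD.1, fun h => hD.2 (hQP D hD.1 h)⟩
  exact ⟨e, F, hF, himm, h0, hinj, hadm,
    fun c hc hmem => hexc c hc ⟨hmem.1, fun h => hmem.2 (hQP _ hmem.1 h)⟩⟩

/-- Trading nothing on the generic side is `TameCensorship` verbatim. [folklore] -/
theorem k3_iff_k3With_trivially : TameCensorship ↔ K3With Trivially := by
  constructor
  · intro h X _ _ _ _ _ _
    refine isTameChristodoulouGeneric_mono ?_ (h X)
    rintro D - ⟨hex, hQ⟩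
    exact ⟨hex, fun 𝒟 hmax => ⟨(hQ 𝒟 hmax).1, (hQ 𝒟 hmax).2.1, (hQ 𝒟 hmax).2.2, trivial⟩⟩
  · intro h X _ _ _ _ _ _
    refine isTameChristodoulouGeneric_mono ?_ (h X)
    rintro D - ⟨hex, hQ⟩
    exact ⟨hex, fun 𝒟 hmax => ⟨(hQ 𝒟 hmax).1, (hQ 𝒟 hmax).2.1, (hQ 𝒟 hmax).2.2.1⟩⟩

/-- **The re-keyed frame still decides the summit**: for ANY traded predicate `G`,
`K2R♭_G → K3♯_G → FinalStateConjecture` (same proof as the route's `closes`: monotonicity of tame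
genericity, pointwise `Q ∧ G ⇒ P`, sub-extremality from `|aᵢ| ≤ Mᵢ` and (i)). With
`G := KerrOrFlat` this is the recommended re-key of the census (§1 of the markdown). [cite: DafermosLuk2017, Conjecture 1] -/
theorem closes_rekeyed (G : DevPred) (h₂ : K2RWith G) (h₃ : K3With G) : FinalStateConjecture := by
  intro X _ _ _ _ _ _
  refine isTameChristodoulouGeneric_mono ?_ (h₃ X)
  rintro D hD ⟨hex, hQ⟩
  refine ⟨hex, fun 𝒟 hmax => ?_⟩
  obtain ⟨hcomp, hi, hii, hG⟩ := hQ 𝒟 hmax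
  obtain ⟨O, d, hO, hrays, hexh, hfo⟩ := h₂ X D hD 𝒟 hmax hcomp hi hii hG
  refine ⟨hcomp, O, d, fun i => ?_, hO, hrays, hexh, hfo⟩
  rcases lt_or_eq_of_le (d.abs_spin_le_mass i) with hlt | heq
  · exact hlt
  · exact absurd ⟨d.τ₀, d.chart i, ⟨(d.isLateChart i).contMDiff, (d.isLateChart i).isOpenEmbedding,
        Set.subset_univ _⟩, d.tendsto_truncDeviationCk i⟩
      (hi (d.motion i).1 (d.motion i).2 (d.mass i) (d.spin i) ⟨heq, d.mass_pos i⟩)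

/-- Monotonicity of the trade in `G`: a stronger traded hypothesis gives a weaker K2R♭. [folklore] -/
theorem k2RWith_mono {G G' : DevPred}
    (hGG' : ∀ (X : Type) [TopologicalSpace X] [ChartedSpace E3 X] [IsManifold (𝓡 3) ∞ X]
      [T2Space X] [SecondCountableTopology X] [ConnectedSpace X] (D : InitialDataSet (𝓡 3) X)
      (𝒟 : VacuumCauchyDevelopment D), G' X D 𝒟 → G X D 𝒟)
    (h : K2RWith G) : K2RWith G' :=
  fun X _ _ _ _ _ _ D hD 𝒟 hmax hcomp hi hii hG' => h X D hD 𝒟 hmax hcomp hi hii (hGG' X D 𝒟 hG')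

/-! ### §2 Decomposition -/

/-- **D2, horizon case split**: K2R is the conjunction of its horizonless piece (`d.N = 0` expected:
"censored tame horizonless developments disperse", the territory of BondiDrainDispersal's
`CensoredHorizonlessDisperseCK` / NoParkingWithoutHorizon's `CompleteSpacetimesDisperse`) and its
black-hole piece ("censored tame developments with an event horizon settle to Kerr exteriors", which
contains smooth black-hole uniqueness and large-data asymptotic stability of the whole sub-extremal
Kerr family). Trivial seam; neither piece is K2R reworded; jointly they ARE K2R. [folklore] -/
theorem k2R_iff_pieces :
    ChannelsResolveTameDevelopmentsR ↔ K2RWith Horizonless ∧ K2RWith BlackHole := by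
  refine ⟨fun h => ⟨k2RWith_of_k2R _ h, k2RWith_of_k2R _ h⟩, fun ⟨h₀, h₁⟩ _ X _ _ _ _ _ _ D hD 𝒟 hmax hcomp hyp => ?_⟩
  by_cases hH : HasEventHorizonR 𝒟
  · exact h₁ X D hD 𝒟 hmax hcomp hyp.1 hyp.2 hH
  · exact h₀ X D hD 𝒟 hmax hcomp hyp.1 hyp.2 hH

/-- **`G` is FORCED by the standing hypotheses**: every MGHD with complete `𝓘⁺`, (i) and (ii) of an
admissible datum satisfies `G`. For `G := KerrOrFlat` this is "silence + rigidity of the tame hull"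
(stubs A, U′, B of the registered line `tame-lasalle-dock`). [folklore] -/
def HypForces (G : DevPred) : Prop :=
  ∀ (X : Type) [TopologicalSpace X] [ChartedSpace E3 X] [IsManifold (𝓡 3) ∞ X] [T2Space X]
    [SecondCountableTopology X] [ConnectedSpace X], ∀ D ∈ admissibleVacuumData X,
    ∀ 𝒟 : VacuumCauchyDevelopment D, 𝒟.IsMaximal →
      Summit.FinalStateConjecture.HasCompleteNullInfinity 𝒟.toCauchyDevelopment →
        NoExtremalRemnant 𝒟 → TameOuter 𝒟 → G X D 𝒟

/-- **D3, the abstract Kenig–Merle cut**: (hypotheses force `G`) → (K2R given `G`) → K2R. With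
`G := KerrOrFlat`: (compactness + rigidity of limits) → (endgame / dock) → K2R — the shape of the
live skeleton, not a new decomposition. [cite: DafermosLuk2017, §1.2.1] -/
theorem k2R_of_forces_of_with (G : DevPred) (hA : HypForces G) (hC : K2RWith G) :
    ChannelsResolveTameDevelopmentsR :=
  fun _ X _ _ _ _ _ _ D hD 𝒟 hmax hcomp hyp =>
    hC X D hD 𝒟 hmax hcomp hyp.1 hyp.2 (hA X D hD 𝒟 hmax hcomp hyp.1 hyp.2)

/-- Conversely K2R gives back the endgame piece for every `G` (so in D3 only `HypForces G` can be
strictly weaker than K2R, and it is iff `G` is not already forced). [folklore] -/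
theorem with_of_k2R (G : DevPred) (h : ChannelsResolveTameDevelopmentsR) : K2RWith G :=
  k2RWith_of_k2R G h

/-! ### §3 Strengthen -/

/-- **K2R⁺_Extra**: K2R with the conclusion strengthened by an extra clause on the witnessing
decomposition (a rate, uniformity, uniqueness of parameters, …). [cite: DafermosLuk2017, Conjecture 1] -/
def K2RPlus (Extra : ∀ (𝓢 : Spacetime.{0} 4) (O : Set 𝓢.carrier), FinalStateDecomposition 𝓢 O 2 → Prop) :
    Prop :=
  ∀ (X : Type) [TopologicalSpace X] [ChartedSpace E3 X] [IsManifold (𝓡 3) ∞ X] [T2Space X]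
    [SecondCountableTopology X] [ConnectedSpace X], ∀ D ∈ admissibleVacuumData X,
    ∀ 𝒟 : VacuumCauchyDevelopment D, 𝒟.IsMaximal →
      Summit.FinalStateConjecture.HasCompleteNullInfinity 𝒟.toCauchyDevelopment →
        NoExtremalRemnant 𝒟 → TameOuter 𝒟 →
          ∃ (O : Set 𝒟.carrier) (d : FinalStateDecomposition 𝒟.toSpacetime O 2),
            (O = Summit.FinalStateConjecture.exteriorOf 𝒟.toCauchyDevelopment d.charted ∧
              Summit.FinalStateConjecture.RaysStayInClosure 𝒟.toCauchyDevelopment O ∧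
                Summit.FinalStateConjecture.HasExhaustiveCharts d ∧
                  Summit.FinalStateConjecture.IsFutureOriented d) ∧
            Extra 𝒟.toSpacetime O d

/-- The POLYNOMIAL (Price-law) RATE clause: near-zone `C²` deviations decay like `τ^{-p}`.
[cite: arXiv:gr-qc/0309115, Thm. 1.1] -/
def PolynomialRate (𝓢 : Spacetime.{0} 4) (O : Set 𝓢.carrier) (d : FinalStateDecomposition 𝓢 O 2) :
    Prop :=
  ∃ C p : ℝ, 0 < p ∧ ∀ (i : Fin d.N) (R : ℝ), ∀ᶠ τ in atTop,
    𝓢.truncDeviationCk (boostedKerrBackground (d.motion i).1 (d.motion i).2 (d.mass i) (d.spin i))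
      (d.chart i) 2 R τ ≤ ENNReal.ofReal (C * τ ^ (-p))

/-- Any strengthened conclusion still contains K2R (projection) — so no `K2R⁺` is easier than K2R
on the `∀`-data side; what a rate or a uniform modulus buys (Łojasiewicz / compactness) it buys only
AFTER the rigidity core. [folklore] -/
theorem k2R_of_plus (Extra : ∀ (𝓢 : Spacetime.{0} 4) (O : Set 𝓢.carrier), FinalStateDecomposition 𝓢 O 2 → Prop)
    (h : K2RPlus Extra) : ChannelsResolveTameDevelopmentsR := by
  intro _ X _ _ _ _ _ _ D hD 𝒟 hmax hcomp hyp
  obtain ⟨O, d, hconcl, -⟩ := h X D hD 𝒟 hmax hcomp hyp.1 hyp.2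
  exact ⟨O, d, hconcl⟩

/-! ### §4 Negation -/

/-- **The typed shape of the (B)/(U) counterexample**: a tame non-settling witness (the disprover's
`Disproof.TameNonSettlingWitness`: admissible datum, certified MGHD, complete `𝓘⁺`, (i), (ii), no
honest `C²` decomposition) whose development carries a TIME-PERIODIC isometry in the sense of
Alexakis–Schlue / item `NoVacuumBreathers` (an isometric, time-orientation-preserving diffeomorphism
moving every point into its own chronological future) — a vacuum breather, or (flow at time 1 of a
Killing field) a smooth stationary non-Kerr black hole. [cite: arXiv:1504.04592, Def. 1.1] -/
def PeriodicTameNonSettlingWitnessExists : Prop :=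
  ∃ w : Disproof.TameNonSettlingWitness,
    ∃ φ : Diffeomorph (𝓡 (3 + 1)) (𝓡 (3 + 1)) w.dev.carrier w.dev.carrier (⊤ : ℕ∞),
      w.dev.metric.IsIsometry w.dev.metric.toPseudoRiemannianMetric φ ∧
        w.dev.timeOrientation.PreservesTimeOrientation φ w.dev.timeOrientation ∧
          ∀ p : w.dev.carrier, φ p ∈ w.dev.metric.chronologicalFuture w.dev.timeOrientation {p}

/-- Such a witness refutes K2R — trivially, through `Disproof.not_k2R_iff_nonempty`; the content is
entirely in the EXISTENCE of the witness (open; conjecturally there is none: its non-existence on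
the tame locus is exactly the rigidity `(B) ∘ (U)` that K2R contains), and in the tree additionally
in the uncertifiable field `isMaximal` (Disproof §3). [cite: arXiv:1504.04592, Thm. 1.1] -/
theorem not_k2R_of_periodicWitness (h : PeriodicTameNonSettlingWitnessExists) :
    ¬ ChannelsResolveTameDevelopmentsR :=
  Disproof.not_k2R_iff_nonempty.2 (let ⟨w, _⟩ := h; ⟨w⟩)

end Summit.FinalStateConjecture.FinalStateConjecture.Cruxes.ChannelsResolveTameDevelopmentsR.CensusS11

end
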